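import Summits.HubbardSuperconductivity.HubbardSuperconductivity.Theorems.SoloBlindGaugeTwist
import HarnessLib

/-!
# Momentum averaging of the pair field under gauge twists

Part 2 of the obstruction lemma (part 1: `SoloBlindGaugeTwist`; part 3: `SoloBlindOrderNotEnergyRobust`).
For every state `ψ` of the Hubbard torus of side `L` and every form factor `g` with `|g| ≤ 1`
(in particular `dWaveFormFactor`):

  `Σ_{m ∈ ℤ/L} re ⟨Δ_g W_mᴴψ, Δ_g W_mᴴψ⟩ ≤ 400 · L⁴ · ‖ψ‖²`   (`sum_twist_pairField_order_le`),

where `Δ_g = pairField g L` and `W_m = twistOp m`. Since long-range order means `⟨Δ_g†Δ_g⟩ ≥ c L⁴` for a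
single state, the bound says that ON AVERAGE over the `L` twisted copies of any state the order parameter
is `O(L³)` — one power short. Mechanism: each pair term `c_{x↑}c_{y↓} - c_{x↓}c_{y↑}` is gauge-covariant
with character `χ(m(x₁+y₁))` (`twistOp_mul_pairTerm_mul_conjTranspose`), so `W_m Δ_g W_mᴴ = Σ_r χ̄(m r) Q_r`
with `Q_r` the slice of `Δ_g` on pairs with `x₁ + y₁ = r` (`pairFieldSlice`,
`twistOp_mul_pairField_mul_conjTranspose`); orthogonality of characters (`sum_toCircle_mul_conj`) gives
`Σ_m ‖Δ_g W_mᴴψ‖² = L Σ_r ‖Q_r ψ‖²`, and each slice has at most `10 L` terms of operator norm `≤ 2`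
(`fibre_count_le`, from `#{a ∈ ℤ/L : a + a = c} ≤ 2`, and `norm_toLp_pairTerm_mulVec_le`).

References: D. J. Scalapino, Phys. Rep. 250 (1995) 329, §2 (pair-field order parameter); the character
sum is `AddChar.sum_eq_ite` for `ZMod.stdAddChar`. Elementary; all declarations tagged [folklore].
-/

noncomputable section

namespace Summit.HubbardSuperconductivity.HubbardSuperconductivity.Theorems

open Matrix Finset Literature.MathematicalPhysics.QuantumLattice
  Literature.MathematicalPhysics.QuantumFieldTheory
open Literature.Probability.LatticeModels (Torus.proj)
open scoped ComplexConjugate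

namespace GaugeTwist

variable {L : ℕ} [NeZero L]

/-! ### Momentum averaging of the pair field

Conjugating the pair field by the twist `W_m` multiplies the pair term at `(x, x+e)` by the phase
`e^{-2πi m (x₁ + (x+e)₁)/L}`; summing `‖Δ_g W_mᴴ ψ‖²` over all windings `m ∈ ℤ/L` and using the
orthogonality of the characters of `ℤ/L` leaves only the "diagonal" `L · Σ_r ‖Q_r ψ‖²`, where
`Q_r` collects the `≤ 10 L` pair terms with `x₁ + (x+e)₁ = r`. Hence
`Σ_m ⟨W_mᴴψ, Δ_g† Δ_g W_mᴴψ⟩ ≤ 400 L⁴ ‖ψ‖²`, one power of `L` SHORT of what `L` states with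
long-range order `⟨Δ_g†Δ_g⟩ ≥ c L⁴` each would give. -/

/-- The singlet pair term `P(x,e) = c_{x↑} c_{x+e,↓} - c_{x↓} c_{x+e,↑}` of `localPair`. [folklore] -/
def pairTerm (x : Site 2 L) (e : Fin 2 → ℤ) :
    Matrix (Finset (Orb (FermionTorus 2 L))) (Finset (Orb (FermionTorus 2 L))) ℂ :=
  annihilation (orb (FermionTorus.ofTorusSite x) 0) *
      annihilation (orb (FermionTorus.ofTorusSite (x + Torus.proj L e)) 1) -
    annihilation (orb (FermionTorus.ofTorusSite x) 1) *
      annihilation (orb (FermionTorus.ofTorusSite (x + Torus.proj L e)) 0)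

/-- `localPair` in terms of `pairTerm`. [folklore] -/
theorem localPair_eq_sum_pairTerm (g : (Fin 2 → ℤ) → ℝ) (x : Site 2 L) :
    localPair g L x = ∑ e ∈ insert 0 unitSteps, ((g e / Real.sqrt 2 : ℝ) : ℂ) • pairTerm x e :=
  rfl

/-- The `e₁`-label `r(x,e) = x₁ + (x+e)₁ ∈ ℤ/L` of the pair `(x, x+e)` ("twice the centre of
mass"): the twist `W_m` multiplies `P(x,e)` by `e^{-2πi m r(x,e)/L}`. [folklore] -/
def pairKey (x : Site 2 L) (e : Fin 2 → ℤ) : ZMod L := x 0 + (x + Torus.proj L e) 0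

/-- **Gauge covariance of the pair terms**: `W_m P(x,e) W_mᴴ = e^{-2πi m r(x,e)/L} P(x,e)`.
Koma–Tasaki, PRL 68 (1992) 3248, eqs. (7)–(8) (`c_x ↦ e^{-iθ_x} c_x`). [folklore] -/
theorem twistOp_mul_pairTerm_mul_conjTranspose (m : ZMod L) (x : Site 2 L) (e : Fin 2 → ℤ) :
    twistOp m * pairTerm x e * (twistOp m)ᴴ =
      conj (ZMod.toCircle (m * pairKey x e) : ℂ) • pairTerm x e := by
  have hk : m * (x + Torus.proj L e) 0 + m * x 0 = m * pairKey x e := by rw [pairKey]; ring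
  have hc : conj (ZMod.toCircle (m * (x + Torus.proj L e) 0) : ℂ) *
      conj (ZMod.toCircle (m * x 0) : ℂ) = conj (ZMod.toCircle (m * pairKey x e) : ℂ) := by
    rw [← map_mul, ← Circle.coe_mul, ← AddChar.map_add_eq_mul, hk]
  unfold pairTerm
  rw [mul_sub, sub_mul, twistOp, phaseGauge_mul_mul_mul_conjTranspose,
    phaseGauge_mul_mul_mul_conjTranspose, phaseGauge_mul_annihilation_mul_conjTranspose,
    phaseGauge_mul_annihilation_mul_conjTranspose, phaseGauge_mul_annihilation_mul_conjTranspose,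
    phaseGauge_mul_annihilation_mul_conjTranspose]
  simp only [FermionTorus.toTorusSite_ofTorusSite, twistChar, Matrix.smul_mul, Matrix.mul_smul,
    smul_smul, hc]
  rw [smul_sub]

/-- `W_m (c P(x,e)) W_mᴴ = e^{-2πi m r(x,e)/L} (c P(x,e))`. [folklore] -/
theorem twistOp_mul_smul_pairTerm_mul_conjTranspose (m : ZMod L) (c : ℂ) (x : Site 2 L)
    (e : Fin 2 → ℤ) :
    twistOp m * (c • pairTerm x e) * (twistOp m)ᴴ =
      conj (ZMod.toCircle (m * pairKey x e) : ℂ) • (c • pairTerm x e) := by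
  rw [Matrix.mul_smul, Matrix.smul_mul, twistOp_mul_pairTerm_mul_conjTranspose, smul_comm]

/-- The label-`r` component `Q_r = Σ_{(x,e) : r(x,e) = r} (g e/√2) P(x,e)` of the pair field
`Δ_g = Σ_r Q_r`. [folklore] -/
def pairFieldSlice (g : (Fin 2 → ℤ) → ℝ) (r : ZMod L) :
    Matrix (Finset (Orb (FermionTorus 2 L))) (Finset (Orb (FermionTorus 2 L))) ℂ :=
  ∑ x : Site 2 L, ∑ e ∈ insert 0 unitSteps,
    if pairKey x e = r then ((g e / Real.sqrt 2 : ℝ) : ℂ) • pairTerm x e else 0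

/-- **The twisted pair field is a character sum of its components**:
`W_m Δ_g W_mᴴ = Σ_{r ∈ ℤ/L} e^{-2πi m r/L} Q_r`. [folklore] -/
theorem twistOp_mul_pairField_mul_conjTranspose (g : (Fin 2 → ℤ) → ℝ) (m : ZMod L) :
    twistOp m * pairField g L * (twistOp m)ᴴ =
      ∑ r : ZMod L, conj (ZMod.toCircle (m * r) : ℂ) • pairFieldSlice g r := by
  simp only [pairField, localPair_eq_sum_pairTerm, Finset.mul_sum, Finset.sum_mul,
    twistOp_mul_smul_pairTerm_mul_conjTranspose]
  symm
  calc ∑ r : ZMod L, conj (ZMod.toCircle (m * r) : ℂ) • pairFieldSlice g r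
      = ∑ r : ZMod L, ∑ x : Site 2 L, ∑ e ∈ insert 0 unitSteps,
          (if pairKey x e = r then
            conj (ZMod.toCircle (m * r) : ℂ) • (((g e / Real.sqrt 2 : ℝ) : ℂ) • pairTerm x e)
          else 0) := by
        simp only [pairFieldSlice, Finset.smul_sum, smul_ite, smul_zero]
    _ = ∑ x : Site 2 L, ∑ e ∈ insert 0 unitSteps, ∑ r : ZMod L,
          (if pairKey x e = r then
            conj (ZMod.toCircle (m * r) : ℂ) • (((g e / Real.sqrt 2 : ℝ) : ℂ) • pairTerm x e)
          else 0) := by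
        rw [Finset.sum_comm]
        exact Finset.sum_congr rfl fun x _ => Finset.sum_comm
    _ = ∑ x : Site 2 L, ∑ e ∈ insert 0 unitSteps,
          conj (ZMod.toCircle (m * pairKey x e) : ℂ) •
            (((g e / Real.sqrt 2 : ℝ) : ℂ) • pairTerm x e) := by
        refine Finset.sum_congr rfl fun x _ => Finset.sum_congr rfl fun e _ => ?_
        exact Fintype.sum_ite_eq (pairKey x e) _

omit [NeZero L] in
/-- The states `W_g v` have the same norm as `v` (`W_g` is unitary). [folklore] -/
theorem star_phaseGauge_mulVec_dotProduct {Λ : Type*} [LinearOrder Λ] [Fintype Λ]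
    (g : Λ → Circle) (v : Fock (Orb Λ)) :
    star (phaseGauge g *ᵥ v) ⬝ᵥ (phaseGauge g *ᵥ v) = star v ⬝ᵥ v := by
  rw [star_mulVec, ← dotProduct_mulVec, mulVec_mulVec, conjTranspose_phaseGauge_mul_self,
    one_mulVec]

/-- `‖W_m v‖ = ‖v‖`. [folklore] -/
theorem star_twistOp_mulVec_dotProduct (m : ZMod L) (v : Fock (Orb (FermionTorus 2 L))) :
    star (twistOp m *ᵥ v) ⬝ᵥ (twistOp m *ᵥ v) = star v ⬝ᵥ v :=
  star_phaseGauge_mulVec_dotProduct _ v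

/-- `‖Δ_g W_mᴴ ψ‖² = Σ_{r,r'} χ_m(r) conj χ_m(r') ⟨Q_r ψ, Q_{r'} ψ⟩`, `χ_m(r) = e^{2πi m r/L}`. [folklore] -/
theorem star_pairField_twist_dotProduct (g : (Fin 2 → ℤ) → ℝ) (m : ZMod L)
    (ψ : Fock (Orb (FermionTorus 2 L))) :
    star (pairField g L *ᵥ ((twistOp m)ᴴ *ᵥ ψ)) ⬝ᵥ (pairField g L *ᵥ ((twistOp m)ᴴ *ᵥ ψ)) =
      ∑ r : ZMod L, ∑ r' : ZMod L,
        (ZMod.toCircle (m * r) : ℂ) * conj (ZMod.toCircle (m * r') : ℂ) *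
          (star (pairFieldSlice g r *ᵥ ψ) ⬝ᵥ (pairFieldSlice g r' *ᵥ ψ)) := by
  rw [← star_twistOp_mulVec_dotProduct m]
  simp only [Matrix.mulVec_mulVec, ← Matrix.mul_assoc]
  rw [twistOp_mul_pairField_mul_conjTranspose, Matrix.sum_mulVec, star_sum, sum_dotProduct]
  refine Finset.sum_congr rfl fun r _ => ?_
  rw [dotProduct_sum]
  refine Finset.sum_congr rfl fun r' _ => ?_
  rw [Matrix.smul_mulVec, Matrix.smul_mulVec, star_smul, smul_dotProduct, dotProduct_smul]
  simp only [smul_eq_mul, Complex.star_def, Complex.conj_conj]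
  ring

/-- **Orthogonality of the characters of `ℤ/L`**:
`Σ_{m ∈ ℤ/L} χ_m(r) conj χ_m(r') = L · [r = r']`. [folklore] -/
theorem sum_toCircle_mul_conj (r r' : ZMod L) :
    ∑ m : ZMod L, (ZMod.toCircle (m * r) : ℂ) * conj (ZMod.toCircle (m * r') : ℂ) =
      if r = r' then (L : ℂ) else 0 := by
  classical
  have h : ∀ m : ZMod L, (ZMod.toCircle (m * r) : ℂ) * conj (ZMod.toCircle (m * r') : ℂ) =
      (ZMod.stdAddChar.mulShift (r - r')) m := by
    intro m
    rw [AddChar.mulShift_apply, ZMod.stdAddChar_apply, ← Circle.coe_inv_eq_conj,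
      ← AddChar.map_neg_eq_inv, ← Circle.coe_mul, ← AddChar.map_add_eq_mul]
    congr 2
    ring
  simp_rw [h]
  rw [AddChar.sum_eq_ite]
  by_cases hr : r = r'
  · subst hr
    rw [sub_self, AddChar.mulShift_zero, AddChar.one_eq_zero, if_pos rfl, if_pos rfl, ZMod.card]
  · rw [if_neg, if_neg hr]
    rw [← AddChar.one_eq_zero]
    exact ZMod.isPrimitive_stdAddChar L (sub_ne_zero.2 hr)

/-- `‖P(x,e) ψ‖ ≤ 2 ‖ψ‖` (two products of two contractions). Bratteli–Robinson II §5.2.2. [folklore] -/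
theorem norm_toLp_pairTerm_mulVec_le (x : Site 2 L) (e : Fin 2 → ℤ)
    (ψ : Fock (Orb (FermionTorus 2 L))) :
    ‖(WithLp.toLp 2 (pairTerm x e *ᵥ ψ) : EuclideanSpace ℂ (Finset (Orb (FermionTorus 2 L))))‖ ≤
      2 * ‖(WithLp.toLp 2 ψ : EuclideanSpace ℂ (Finset (Orb (FermionTorus 2 L))))‖ := by
  unfold pairTerm
  rw [Matrix.sub_mulVec, ← Matrix.mulVec_mulVec, ← Matrix.mulVec_mulVec, WithLp.toLp_sub, two_mul]
  exact (norm_sub_le _ _).trans (add_le_add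
    ((norm_toLp_annihilation_mulVec_le _ _).trans (norm_toLp_annihilation_mulVec_le _ _))
    ((norm_toLp_annihilation_mulVec_le _ _).trans (norm_toLp_annihilation_mulVec_le _ _)))

/-- In `ℤ/L` the equation `a + a = c` has at most two solutions. [folklore] -/
theorem card_filter_add_self_eq_le_two (c : ZMod L) :
    (Finset.univ.filter fun a : ZMod L => a + a = c).card ≤ 2 := by
  have hsub : (Finset.univ.filter fun a : ZMod L => a + a = c) ⊆
      {((c.val / 2 : ℕ) : ZMod L), (((c.val + L) / 2 : ℕ) : ZMod L)} := by
    intro a ha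
    rw [Finset.mem_filter] at ha
    have h := congrArg ZMod.val ha.2
    rw [ZMod.val_add] at h
    have haL : a.val < L := ZMod.val_lt a
    rw [Finset.mem_insert, Finset.mem_singleton, ← ZMod.natCast_zmod_val a]
    rcases Nat.lt_or_ge (a.val + a.val) L with hlt | hge
    · left
      rw [Nat.mod_eq_of_lt hlt] at h
      congr 1
      omega
    · right
      rw [Nat.mod_eq_sub_mod hge, Nat.mod_eq_of_lt (by omega)] at h
      congr 1
      omega
  exact (Finset.card_le_card hsub).trans Finset.card_le_two

/-- `#{x ∈ (ℤ/L)² : x₁ + x₁ = c} ≤ 2L`. [folklore] -/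
theorem card_filter_apply_add_self_eq_le (c : ZMod L) :
    (Finset.univ.filter fun x : Site 2 L => x 0 + x 0 = c).card ≤ 2 * L := by
  classical
  calc (Finset.univ.filter fun x : Site 2 L => x 0 + x 0 = c).card
      ≤ ((Finset.univ.filter fun a : ZMod L => a + a = c) ×ˢ (Finset.univ : Finset (ZMod L))).card := by
        refine Finset.card_le_card_of_injOn (fun x => (x 0, x 1)) ?_ ?_
        · intro x hx
          rw [Finset.mem_coe, Finset.mem_filter] at hx
          rw [Finset.mem_coe, Finset.mem_product, Finset.mem_filter]
          exact ⟨⟨Finset.mem_univ _, hx.2⟩, Finset.mem_univ _⟩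
        · intro x _ y _ hxy
          simp only [Prod.mk.injEq] at hxy
          funext i
          fin_cases i
          · simpa using hxy.1
          · simpa using hxy.2
    _ = (Finset.univ.filter fun a : ZMod L => a + a = c).card * L := by
        rw [Finset.card_product, Finset.card_univ, ZMod.card]
    _ ≤ 2 * L := Nat.mul_le_mul_right _ (card_filter_add_self_eq_le_two c)

/-- `#{x ∈ (ℤ/L)² : x₁ + x₁ = c} ≤ 2L`, as a real indicator sum. [folklore] -/
theorem sum_ite_add_self_eq_le (c : ZMod L) :
    ∑ x : Site 2 L, (if x 0 + x 0 = c then (1 : ℝ) else 0) ≤ 2 * L := by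
  rw [Finset.sum_boole]
  exact_mod_cast card_filter_apply_add_self_eq_le c

/-- **Fibre count**: at most `10 L` pairs `(x,e)`, `e ∈ {0, ±e₁, ±e₂}`, share a label `r(x,e) = r`. [folklore] -/
theorem fibre_count_le (r : ZMod L) :
    ∑ x : Site 2 L, ∑ e ∈ insert 0 unitSteps, (if pairKey x e = r then (1 : ℝ) else 0) ≤ 10 * L := by
  classical
  have hE : (insert (0 : Fin 2 → ℤ) unitSteps).card ≤ 5 := by
    refine (Finset.card_insert_le _ _).trans ?_
    have : (unitSteps).card ≤ 4 := by rw [unitSteps]; exact Finset.card_le_four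
    omega
  have hkey : ∀ (x : Site 2 L) (e : Fin 2 → ℤ),
      pairKey x e = r ↔ x 0 + x 0 = r - ((e 0 : ℤ) : ZMod L) := by
    intro x e
    rw [pairKey, Pi.add_apply, Literature.Probability.LatticeModels.Torus.proj_apply,
      eq_sub_iff_add_eq, add_assoc]
  rw [Finset.sum_comm]
  simp_rw [hkey]
  calc ∑ e ∈ insert 0 unitSteps, ∑ x : Site 2 L,
        (if x 0 + x 0 = r - ((e 0 : ℤ) : ZMod L) then (1 : ℝ) else 0)
      ≤ ∑ e ∈ insert (0 : Fin 2 → ℤ) unitSteps, (2 * L : ℝ) :=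
        Finset.sum_le_sum fun e _ => sum_ite_add_self_eq_le _
    _ = (insert (0 : Fin 2 → ℤ) unitSteps).card * (2 * L) := by
        rw [Finset.sum_const, nsmul_eq_mul]
    _ ≤ 5 * (2 * L) := by gcongr; exact_mod_cast hE
    _ = 10 * L := by ring

/-- **The components are uniformly bounded**: `‖Q_r ψ‖ ≤ 20 L ‖ψ‖` when `|g| ≤ 1`. [folklore] -/
theorem norm_toLp_pairFieldSlice_mulVec_le (g : (Fin 2 → ℤ) → ℝ) (hg : ∀ e, |g e| ≤ 1)
    (r : ZMod L) (ψ : Fock (Orb (FermionTorus 2 L))) :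
    ‖(WithLp.toLp 2 (pairFieldSlice g r *ᵥ ψ) : EuclideanSpace ℂ (Finset (Orb (FermionTorus 2 L))))‖ ≤
      20 * L * ‖(WithLp.toLp 2 ψ : EuclideanSpace ℂ (Finset (Orb (FermionTorus 2 L))))‖ := by
  have h2 : (1 : ℝ) ≤ Real.sqrt 2 := by
    have := Real.sqrt_le_sqrt (show (1 : ℝ) ≤ 2 by norm_num)
    rwa [Real.sqrt_one] at this
  have hcoef : ∀ e, ‖((g e / Real.sqrt 2 : ℝ) : ℂ)‖ ≤ 1 := by
    intro e
    rw [Complex.norm_real, Real.norm_eq_abs, abs_div, abs_of_pos (Real.sqrt_pos.2 two_pos)]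
    exact (div_le_self (abs_nonneg _) h2).trans (hg e)
  have hterm : ∀ (x : Site 2 L) (e : Fin 2 → ℤ),
      ‖(WithLp.toLp 2 ((if pairKey x e = r then ((g e / Real.sqrt 2 : ℝ) : ℂ) • pairTerm x e
          else 0) *ᵥ ψ) : EuclideanSpace ℂ (Finset (Orb (FermionTorus 2 L))))‖ ≤
        (if pairKey x e = r then (1 : ℝ) else 0) *
          (2 * ‖(WithLp.toLp 2 ψ : EuclideanSpace ℂ (Finset (Orb (FermionTorus 2 L))))‖) := by
    intro x e
    split_ifs with h
    · rw [Matrix.smul_mulVec, WithLp.toLp_smul, norm_smul, one_mul]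
      exact (mul_le_mul (hcoef e) (norm_toLp_pairTerm_mulVec_le x e ψ) (norm_nonneg _)
        zero_le_one).trans_eq (one_mul _)
    · rw [Matrix.zero_mulVec, WithLp.toLp_zero, norm_zero, zero_mul]
  unfold pairFieldSlice
  simp only [Matrix.sum_mulVec, WithLp.toLp_sum]
  calc _ ≤ ∑ x : Site 2 L, ∑ e ∈ insert 0 unitSteps,
          ‖(WithLp.toLp 2 ((if pairKey x e = r then ((g e / Real.sqrt 2 : ℝ) : ℂ) • pairTerm x e
            else 0) *ᵥ ψ) : EuclideanSpace ℂ (Finset (Orb (FermionTorus 2 L))))‖ :=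
        (norm_sum_le _ _).trans (Finset.sum_le_sum fun x _ => norm_sum_le _ _)
    _ ≤ ∑ x : Site 2 L, ∑ e ∈ insert 0 unitSteps, (if pairKey x e = r then (1 : ℝ) else 0) *
          (2 * ‖(WithLp.toLp 2 ψ : EuclideanSpace ℂ (Finset (Orb (FermionTorus 2 L))))‖) :=
        Finset.sum_le_sum fun x _ => Finset.sum_le_sum fun e _ => hterm x e
    _ = (∑ x : Site 2 L, ∑ e ∈ insert 0 unitSteps, (if pairKey x e = r then (1 : ℝ) else 0)) *
          (2 * ‖(WithLp.toLp 2 ψ : EuclideanSpace ℂ (Finset (Orb (FermionTorus 2 L))))‖) := by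
        simp only [Finset.sum_mul]
    _ ≤ 10 * L * (2 * ‖(WithLp.toLp 2 ψ : EuclideanSpace ℂ (Finset (Orb (FermionTorus 2 L))))‖) := by
        gcongr
        exact fibre_count_le r
    _ = _ := by ring

/-- **Momentum averaging of the pair-field order** (Plancherel over the twists): for every state
`ψ` and every form factor `|g| ≤ 1`,
`Σ_{m ∈ ℤ/L} ⟨W_mᴴψ, Δ_g† Δ_g W_mᴴψ⟩ = L Σ_r ‖Q_r ψ‖² ≤ 400 L⁴ ‖ψ‖²`.
So on average over the `L` twisted copies of `ψ` the order parameter is `≤ 400 L³ ‖ψ‖²`, a factor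
`L` below the long-range-order scale `L⁴`. [folklore] -/
theorem sum_twist_pairField_order_le (g : (Fin 2 → ℤ) → ℝ) (hg : ∀ e, |g e| ≤ 1)
    (ψ : Fock (Orb (FermionTorus 2 L))) :
    ∑ m : ZMod L, (star (pairField g L *ᵥ ((twistOp m)ᴴ *ᵥ ψ)) ⬝ᵥ
        (pairField g L *ᵥ ((twistOp m)ᴴ *ᵥ ψ))).re ≤ 400 * (L : ℝ) ^ 4 * (star ψ ⬝ᵥ ψ).re := by
  have hsum : ∑ m : ZMod L, star (pairField g L *ᵥ ((twistOp m)ᴴ *ᵥ ψ)) ⬝ᵥ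
        (pairField g L *ᵥ ((twistOp m)ᴴ *ᵥ ψ)) =
      (L : ℂ) * ∑ r : ZMod L, star (pairFieldSlice g r *ᵥ ψ) ⬝ᵥ (pairFieldSlice g r *ᵥ ψ) := by
    simp_rw [star_pairField_twist_dotProduct]
    rw [Finset.sum_comm, Finset.mul_sum]
    refine Finset.sum_congr rfl fun r _ => ?_
    rw [Finset.sum_comm]
    calc ∑ r' : ZMod L, ∑ m : ZMod L, (ZMod.toCircle (m * r) : ℂ) * conj (ZMod.toCircle (m * r') : ℂ) *
            (star (pairFieldSlice g r *ᵥ ψ) ⬝ᵥ (pairFieldSlice g r' *ᵥ ψ))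
        = ∑ r' : ZMod L, (∑ m : ZMod L, (ZMod.toCircle (m * r) : ℂ) * conj (ZMod.toCircle (m * r') : ℂ)) *
            (star (pairFieldSlice g r *ᵥ ψ) ⬝ᵥ (pairFieldSlice g r' *ᵥ ψ)) := by
          simp_rw [Finset.sum_mul]
      _ = ∑ r' : ZMod L, (if r = r' then (L : ℂ) else 0) *
            (star (pairFieldSlice g r *ᵥ ψ) ⬝ᵥ (pairFieldSlice g r' *ᵥ ψ)) := by
          simp_rw [sum_toCircle_mul_conj]
      _ = (L : ℂ) * (star (pairFieldSlice g r *ᵥ ψ) ⬝ᵥ (pairFieldSlice g r *ᵥ ψ)) := by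
          simp_rw [ite_mul, zero_mul]
          exact Fintype.sum_ite_eq r _
  have hslice : ∀ r : ZMod L,
      (star (pairFieldSlice g r *ᵥ ψ) ⬝ᵥ (pairFieldSlice g r *ᵥ ψ)).re ≤
        400 * (L : ℝ) ^ 2 * (star ψ ⬝ᵥ ψ).re := by
    intro r
    rw [← norm_toLp_sq_eq_re, ← norm_toLp_sq_eq_re]
    calc _ ≤ (20 * L * ‖(WithLp.toLp 2 ψ : EuclideanSpace ℂ (Finset (Orb (FermionTorus 2 L))))‖) ^ 2 := by
          gcongr
          exact norm_toLp_pairFieldSlice_mulVec_le g hg r ψ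
      _ = _ := by ring
  rw [← Complex.re_sum, hsum]
  simp only [Complex.mul_re, Complex.natCast_re, Complex.natCast_im, zero_mul, sub_zero,
    Complex.re_sum]
  calc (L : ℝ) * ∑ r : ZMod L, (star (pairFieldSlice g r *ᵥ ψ) ⬝ᵥ (pairFieldSlice g r *ᵥ ψ)).re
      ≤ (L : ℝ) * ∑ r : ZMod L, 400 * (L : ℝ) ^ 2 * (star ψ ⬝ᵥ ψ).re := by
        gcongr with r _
        exact hslice r
    _ = 400 * (L : ℝ) ^ 4 * (star ψ ⬝ᵥ ψ).re := by
        rw [Finset.sum_const, Finset.card_univ, ZMod.card, nsmul_eq_mul]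
        ring

end GaugeTwist

end Summit.HubbardSuperconductivity.HubbardSuperconductivity.Theorems
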